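import Mathlib.Algebra.MvPolynomial.PDeriv
import Mathlib.Algebra.MvPolynomial.CommRing
import Mathlib.RingTheory.MvPolynomial.Basic
import Mathlib.RingTheory.Ideal.Operations
import Mathlib.RingTheory.Ideal.Maps
import Mathlib.Algebra.Polynomial.Coeff
import Mathlib.Data.Fin.VecNotation
import Mathlib.Tactic
import HarnessLib
import Literature.AlgebraicGeometry.Hironaka2017.Datum

/-!
# Kill test K3.2 (LADDER-RESOLUTION rung L, slot W3.2 «canonical strata instead of Ě», Hilbert–Samuel door): the W-Q
# hypersurface `fW` on `𝔸⁵` in characteristic 2 — three curves of its top-multiplicity locus and the first-order edge data along them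

Cell `res-hironaka`, seat `res-L1-k32` (prereg `L/res-L1-k32/PREREG-K3.2.md` frozen 2026-08-26T18:40:11Z; report
`L/res-L1-k32/KILL-TEST-K3.2.md`; CAS cross-check kit job j258399, re-run j259192 by res-L1-repro-2). HONEST FRAMING:
«[OURS · L1 W3.2] kill-test helper; NOT a statement of the manuscript.» Every declaration is an explicit polynomial identity,
an evaluation, an ideal membership in `R[x,y,z,w,v] = MvPolynomial (Fin 5) R` over an ARBITRARY commutative ring `R`
(characteristic 2 enters only through displayed factors `2·(…)`), a coefficient computation in `R[s]`, or an elementary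
fact about the tree's value type `Datum.EdgeInv` (tag `[folklore]`). NOTHING here asserts a statement of H. Hironaka's
manuscript (2017-03-23, [claim: Hironaka2017, status: under-review]); its clauses (geometric `℘`, p.17 l.1–3; Th. 4.1 (1)(2)
p.17; items (6)–(8) p.19, Def. 4.9/4.11 pp.20–21, Eq. (25); Eq. (34) p.24; §6.1 p.29; Eq. (43) p.30) are quoted for locators
only, and the glue from these certificates to «`t(Γ₂(μ)) ≥ 2`, `t(0) ≤ 1`, hence `Inv(Ê)` is not constant on the top locus» is
the hand argument of the report §2–§3 under those clauses as CANDIDATE premises — not a kernel theorem.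

The companion witness `y² − x²z² + x⁵` (char 3) of the same kill test is NOT re-typed here: its polynomial layer and the
comparison `(3,1,1,1) < (3,2,1)`, `invmaxStratum = {O}`, are the tree files `MarkedTransferCampaignW31QuinticEdgeData`,
`…QuinticEdgeAlgebras`, `…InvOrderConvention` of kill test K3.1 (seat res-L1-k31; p463820, p463819, p461082), cited by the report.

Contents (`x,y,z,w,v = X 0,…,X 4`; `fW = x² + wv⁶ + zw⁵v² + yz²wv⁴ + yz³w⁵ + yz⁹ + y⁴zw²v² + y¹¹`, the normal form of
GAP-LEDGER R18 / K4.2 W2, quasi-homogeneous of weights `(99,18,20,24,29)`, `fW2_torus`):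
* §1 the five first partials as explicit polynomials (`pderiv*_fW2`; `∂_x fW = 2x`, `∂_v fW = 2·Dv2` vanish in characteristic 2;
  since `x²` is a monomial of `fW`, no point has multiplicity `> 2`: the top-multiplicity locus is `V(fW, ∂fW)` = `Sing(Ê)`,
  `Ê = E = (fW, 2)`, §6.1 p.29 — read in the report, re-checked by the CAS job);
* §2 THREE CURVES OF THE TOP LOCUS through `0`: `γ(s) = (s⁹⁹,s¹⁸,s²⁰,s²⁴,s²⁹)` (`gammaW_*`: values `8s¹⁹⁸, 18s¹⁸⁰, 16s¹⁷⁸,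
  14s¹⁷⁴` — all `2·(…)`), `Γ₂(μ) = (0,0,μ⁵,μ⁶,0)` (`gammaTwo_*`: `0, 2μ⁴⁵, 0, 0, 0`) and the `w`-axis (`wAxis_*`: all `0`);
* §3 FIRST-ORDER EDGE DATA: at `Γ₂(μ)` the gradients of `∂_y fW` and `∂_w fW` are `(0,0,12μ⁴⁰,5μ³⁹,0)` and `(0,5μ³⁹,0,0,0)`
  (`W2_grad_Dy`, `W2_grad_Dw`): in characteristic 2, for `μ ≠ 0`, two elements of `Diff⁽¹⁾(fW)` of ORDER 1 with independent
  initial forms `μ³⁹w̄`, `μ³⁹ȳ` — already at the `𝔽₂`-point `(0,0,1,1,0)`; the mixed second partials are `(12μ⁴⁰, 5μ³⁹, 0)` on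
  `Γ₂` (tangent quadric NOT diagonal) and `(18s¹⁶⁰, 14s¹⁵⁶, 24s¹⁵⁴) = 2·(…)` on `γ` (diagonal; no first partial of order 1
  there) (`W2_cross_G2`, `W2_cross_gamma`);
* §4 THE ORIGIN: `γ*(𝔪²) ⊆ (s³⁶)` and `origin_linear_coeffs`: a germ `Σ cᵢxᵢ + r`, `r ∈ 𝔪²`, vanishing on `γ` has
  `c_y = c_z = c_w = c_v = 0` (the coefficients of `s¹⁸, s²⁰, s²⁴, s²⁹`) — so an order-1 germ vanishing on the top locus has
  initial form `∝ x̄`;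
* §0 `edgeInv_ne_of_count_one` / `edgeInv_lt_of_length`: `Inv` values with `≤ 1` vs `≥ 2` exponent-one entries differ.

Host item: MarkedTransfer `HypersurfaceOrderReduction` (stmt-ResolutionOfSingularities-16155), as for the K3.1/K3.4 helpers —
`(𝔸⁵, (fW), ∅, 2)` is a marked hypersurface ideal of its type. No new route, no new item.

## References
* H. Hironaka, ms. 2017-03-23 [Hironaka2017]: p.17 l.1–3, Th. 4.1 p.17, p.19 (6)–(8), Def. 4.9/4.11 pp.20–21, Eq. (34) p.24,
  §6.1–6.2 pp.29–30 — locators only.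
* V. Cossart, U. Jannsen, S. Saito, LNM 2270 (2020), Def. 2.28/2.35 (Hilbert–Samuel function and locus; for a hypersurface in a
  regular scheme `H_X(x)` is determined by the multiplicity) [CossartJannsenSaito2020] — report only.
* Cell files `L/res-L1-k32/*K3.2.md`; kit jobs j258399 / j259192.
-/

set_option linter.dupNamespace false -- mandated namespace of this single-conjunct summit

namespace Summit.ResolutionOfSingularities.ResolutionOfSingularities.Theorems.CampaignW32WQTopLocus

open MvPolynomial

/-- Partial derivatives kill numerals (`pderiv i 2 = 0`, …). [folklore] -/
@[simp] theorem pderiv_ofNat_eq_zero {σ S : Type*} [CommSemiring S] (i : σ) (n : ℕ) [n.AtLeastTwo] :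
    pderiv i (ofNat(n) : MvPolynomial σ S) = 0 := by
  rw [← Nat.cast_ofNat (R := MvPolynomial σ S) (n := n)]
  exact Derivation.map_natCast _ _

/-! ## The counting lemma on `Inv` values -/

section Inv

open Literature.AlgebraicGeometry.Hironaka2017.Datum

/-- Values of `Inv` (tree value type `Datum.EdgeInv`, Eq. (34) p.24 read as the list of edge exponents) with different
numbers of exponent-`1` entries — `t` = number of degree-1 edge generators — are different: used below with
`t(0) ≤ 1 < 2 ≤ t(Γ₂(μ))`. [folklore] -/
theorem edgeInv_ne_of_count_one {n : ℕ} (v w : EdgeInv n) (hv : v.q.count 1 ≤ 1) (hw : 2 ≤ w.q.count 1) :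
    v ≠ w := by
  rintro rfl
  omega

/-- If moreover `v` has a single generator of exponent `≥ 2` while `w` has at least two generators, then `w < v`
(Hironaka's order compares `n − r` first): the shape of the comparison `Inv_{Γ₂(μ)} < (5,4,2)`. [folklore] -/
theorem edgeInv_lt_of_length {n : ℕ} (v w : EdgeInv n) (hv : v.q.length = 1) (hw : 2 ≤ w.q.length) : w < v :=
  EdgeInv.key_lt_of_length_lt v w (by omega)

end Inv

/-! ## W2 — the W-Q normal form on `𝔸⁵`, characteristic 2 -/

section W2

variable {R : Type*} [CommRing R]

/-- `fW = x² + wv⁶ + zw⁵v² + yz²wv⁴ + yz³w⁵ + yz⁹ + y⁴zw²v² + y¹¹` (`x,y,z,w,v = X 0,…,X 4`; the R18 / K4.2 normal form,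
re-entered here as OURS). [folklore] -/
noncomputable def fW2 : (MvPolynomial (Fin 5) R) :=
  X 0 ^ 2 + X 3 * X 4 ^ 6 + X 2 * X 3 ^ 5 * X 4 ^ 2 + X 1 * X 2 ^ 2 * X 3 * X 4 ^ 4 + X 1 * X 2 ^ 3 * X 3 ^ 5
    + X 1 * X 2 ^ 9 + X 1 ^ 4 * X 2 * X 3 ^ 2 * X 4 ^ 2 + X 1 ^ 11

/-- `∂_y fW`. [folklore] -/
noncomputable def Dy : (MvPolynomial (Fin 5) R) :=
  X 2 ^ 2 * X 3 * X 4 ^ 4 + X 2 ^ 3 * X 3 ^ 5 + 4 * X 1 ^ 3 * X 2 * X 3 ^ 2 * X 4 ^ 2 + X 2 ^ 9 + 11 * X 1 ^ 10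
/-- `∂_z fW`. [folklore] -/
noncomputable def Dz : (MvPolynomial (Fin 5) R) :=
  X 3 ^ 5 * X 4 ^ 2 + 2 * X 1 * X 2 * X 3 * X 4 ^ 4 + 3 * X 1 * X 2 ^ 2 * X 3 ^ 5 + X 1 ^ 4 * X 3 ^ 2 * X 4 ^ 2
    + 9 * X 1 * X 2 ^ 8
/-- `∂_w fW`. [folklore] -/
noncomputable def Dw : (MvPolynomial (Fin 5) R) :=
  X 4 ^ 6 + 5 * X 2 * X 3 ^ 4 * X 4 ^ 2 + X 1 * X 2 ^ 2 * X 4 ^ 4 + 5 * X 1 * X 2 ^ 3 * X 3 ^ 4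
    + 2 * X 1 ^ 4 * X 2 * X 3 * X 4 ^ 2
/-- `∂_v fW / 2` (exact over `ℤ`). [folklore] -/
noncomputable def Dv2 : (MvPolynomial (Fin 5) R) :=
  3 * X 3 * X 4 ^ 5 + X 2 * X 3 ^ 5 * X 4 + 2 * X 1 * X 2 ^ 2 * X 3 * X 4 ^ 3 + X 1 ^ 4 * X 2 * X 3 ^ 2 * X 4

/-- `∂_x fW = 2x` (zero in characteristic 2). [folklore] -/
theorem pderiv0_fW2 : pderiv 0 (fW2 : (MvPolynomial (Fin 5) R)) = 2 * X 0 := by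
  simp only [fW2]
  simp [Derivation.leibniz, Derivation.leibniz_pow, pderiv_X, smul_eq_mul]
/-- `∂_y fW = Dy`. [folklore] -/
theorem pderiv1_fW2 : pderiv 1 (fW2 : (MvPolynomial (Fin 5) R)) = Dy := by
  simp only [fW2, Dy]
  simp [Derivation.leibniz, Derivation.leibniz_pow, pderiv_X, smul_eq_mul]
  ring
/-- `∂_z fW = Dz`. [folklore] -/
theorem pderiv2_fW2 : pderiv 2 (fW2 : (MvPolynomial (Fin 5) R)) = Dz := by
  simp only [fW2, Dz]
  simp [Derivation.leibniz, Derivation.leibniz_pow, pderiv_X, smul_eq_mul]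
  ring
/-- `∂_w fW = Dw`. [folklore] -/
theorem pderiv3_fW2 : pderiv 3 (fW2 : (MvPolynomial (Fin 5) R)) = Dw := by
  simp only [fW2, Dw]
  simp [Derivation.leibniz, Derivation.leibniz_pow, pderiv_X, smul_eq_mul]
  ring
/-- `∂_v fW = 2·Dv2` (zero in characteristic 2). [folklore] -/
theorem pderiv4_fW2 : pderiv 4 (fW2 : (MvPolynomial (Fin 5) R)) = 2 * Dv2 := by
  simp only [fW2, Dv2]
  simp [Derivation.leibniz, Derivation.leibniz_pow, pderiv_X, smul_eq_mul]
  ring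

/-- Quasi-homogeneity: weights `(99,18,20,24,29)`, degree `198`. [folklore] -/
theorem fW2_torus (l : R) :
    bind₁ (![C (l ^ 99) * X 0, C (l ^ 18) * X 1, C (l ^ 20) * X 2, C (l ^ 24) * X 3, C (l ^ 29) * X 4] : Fin 5 → (MvPolynomial (Fin 5) R))
      fW2 = C (l ^ 198) * fW2 := by
  simp only [fW2, map_add, map_mul, map_pow, bind₁_X_right, Matrix.cons_val_zero, Matrix.cons_val_one,
    Matrix.cons_val]
  ring

/-! ### Three curves of the top locus through `0` (the parameter is the variable `X 0` of the target) -/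

/-- The curve `γ(s) = (s⁹⁹, s¹⁸, s²⁰, s²⁴, s²⁹)` (`s = X 0`). [folklore] -/
noncomputable def gammaW : (MvPolynomial (Fin 5) R) →ₐ[R] (MvPolynomial (Fin 5) R) := bind₁ ![X 0 ^ 99, X 0 ^ 18, X 0 ^ 20, X 0 ^ 24, X 0 ^ 29]
/-- The curve `Γ₂(μ) = (0, 0, μ⁵, μ⁶, 0)` (`μ = X 0`). [folklore] -/
noncomputable def gammaTwo : (MvPolynomial (Fin 5) R) →ₐ[R] (MvPolynomial (Fin 5) R) := bind₁ ![0, 0, X 0 ^ 5, X 0 ^ 6, 0]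
/-- The `w`-axis `(0, 0, 0, μ, 0)` (`μ = X 0`). [folklore] -/
noncomputable def wAxis : (MvPolynomial (Fin 5) R) →ₐ[R] (MvPolynomial (Fin 5) R) := bind₁ ![0, 0, 0, X 0, 0]

/-- `fW(γ(s)) = 8 s¹⁹⁸` (`= 0` in characteristic 2). [folklore] -/
theorem gammaW_fW2 : gammaW (fW2 : (MvPolynomial (Fin 5) R)) = 8 * X 0 ^ 198 := by
  simp only [gammaW, fW2, map_add, map_mul, map_pow, bind₁_X_right, Matrix.cons_val_zero, Matrix.cons_val_one,
    Matrix.cons_val]; ring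
/-- `∂_y fW (γ(s)) = 18 s¹⁸⁰`. [folklore] -/
theorem gammaW_Dy : gammaW (Dy : (MvPolynomial (Fin 5) R)) = 18 * X 0 ^ 180 := by
  simp only [gammaW, Dy, map_add, map_mul, map_pow, bind₁_X_right, Matrix.cons_val_zero, Matrix.cons_val_one,
    Matrix.cons_val, map_ofNat]; ring
/-- `∂_z fW (γ(s)) = 16 s¹⁷⁸`. [folklore] -/
theorem gammaW_Dz : gammaW (Dz : (MvPolynomial (Fin 5) R)) = 16 * X 0 ^ 178 := by
  simp only [gammaW, Dz, map_add, map_mul, map_pow, bind₁_X_right, Matrix.cons_val_zero, Matrix.cons_val_one,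
    Matrix.cons_val, map_ofNat]; ring
/-- `∂_w fW (γ(s)) = 14 s¹⁷⁴`. [folklore] -/
theorem gammaW_Dw : gammaW (Dw : (MvPolynomial (Fin 5) R)) = 14 * X 0 ^ 174 := by
  simp only [gammaW, Dw, map_add, map_mul, map_pow, bind₁_X_right, Matrix.cons_val_zero, Matrix.cons_val_one,
    Matrix.cons_val, map_ofNat]; ring

/-- `fW(Γ₂(μ)) = 0` (every characteristic). [folklore] -/
theorem gammaTwo_fW2 : gammaTwo (fW2 : (MvPolynomial (Fin 5) R)) = 0 := by
  simp only [gammaTwo, fW2, map_add, map_mul, map_pow, bind₁_X_right, Matrix.cons_val_zero, Matrix.cons_val_one,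
    Matrix.cons_val]; ring
/-- `∂_y fW (Γ₂(μ)) = 2 μ⁴⁵` (`= 0` in characteristic 2). [folklore] -/
theorem gammaTwo_Dy : gammaTwo (Dy : (MvPolynomial (Fin 5) R)) = 2 * X 0 ^ 45 := by
  simp only [gammaTwo, Dy, map_add, map_mul, map_pow, bind₁_X_right, Matrix.cons_val_zero, Matrix.cons_val_one,
    Matrix.cons_val, map_ofNat]; ring
/-- `∂_z fW (Γ₂(μ)) = 0`. [folklore] -/
theorem gammaTwo_Dz : gammaTwo (Dz : (MvPolynomial (Fin 5) R)) = 0 := by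
  simp only [gammaTwo, Dz, map_add, map_mul, map_pow, bind₁_X_right, Matrix.cons_val_zero, Matrix.cons_val_one,
    Matrix.cons_val, map_ofNat]; ring
/-- `∂_w fW (Γ₂(μ)) = 0`. [folklore] -/
theorem gammaTwo_Dw : gammaTwo (Dw : (MvPolynomial (Fin 5) R)) = 0 := by
  simp only [gammaTwo, Dw, map_add, map_mul, map_pow, bind₁_X_right, Matrix.cons_val_zero, Matrix.cons_val_one,
    Matrix.cons_val, map_ofNat]; ring
/-- `(∂_v fW / 2)(Γ₂(μ)) = 0`. [folklore] -/
theorem gammaTwo_Dv2 : gammaTwo (Dv2 : (MvPolynomial (Fin 5) R)) = 0 := by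
  simp only [gammaTwo, Dv2, map_add, map_mul, map_pow, bind₁_X_right, Matrix.cons_val_zero, Matrix.cons_val_one,
    Matrix.cons_val, map_ofNat]; ring

/-- `fW` vanishes on the `w`-axis. [folklore] -/
theorem wAxis_fW2 : wAxis (fW2 : (MvPolynomial (Fin 5) R)) = 0 := by
  simp only [wAxis, fW2, map_add, map_mul, map_pow, bind₁_X_right, Matrix.cons_val_zero, Matrix.cons_val_one,
    Matrix.cons_val]; ring
/-- `∂_y fW` vanishes on the `w`-axis. [folklore] -/
theorem wAxis_Dy : wAxis (Dy : (MvPolynomial (Fin 5) R)) = 0 := by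
  simp only [wAxis, Dy, map_add, map_mul, map_pow, bind₁_X_right, Matrix.cons_val_zero, Matrix.cons_val_one,
    Matrix.cons_val, map_ofNat]; ring
/-- `∂_z fW` vanishes on the `w`-axis. [folklore] -/
theorem wAxis_Dz : wAxis (Dz : (MvPolynomial (Fin 5) R)) = 0 := by
  simp only [wAxis, Dz, map_add, map_mul, map_pow, bind₁_X_right, Matrix.cons_val_zero, Matrix.cons_val_one,
    Matrix.cons_val, map_ofNat]; ring
/-- `∂_w fW` vanishes on the `w`-axis. [folklore] -/
theorem wAxis_Dw : wAxis (Dw : (MvPolynomial (Fin 5) R)) = 0 := by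
  simp only [wAxis, Dw, map_add, map_mul, map_pow, bind₁_X_right, Matrix.cons_val_zero, Matrix.cons_val_one,
    Matrix.cons_val, map_ofNat]; ring
/-- `∂_v fW / 2` vanishes on the `w`-axis. [folklore] -/
theorem wAxis_Dv2 : wAxis (Dv2 : (MvPolynomial (Fin 5) R)) = 0 := by
  simp only [wAxis, Dv2, map_add, map_mul, map_pow, bind₁_X_right, Matrix.cons_val_zero, Matrix.cons_val_one,
    Matrix.cons_val, map_ofNat]; ring

/-! ### Order-1 elements at `Γ₂(μ)`: gradients of `∂_y fW` and `∂_w fW` -/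

/-- The point `Γ₂(μ) = (0,0,μ⁵,μ⁶,0)`. [folklore] -/
def ptG2 (μ : R) : Fin 5 → R := ![0, 0, μ ^ 5, μ ^ 6, 0]

/-- Gradient of `∂_y fW` at `Γ₂(μ)`: `(0, 0, 12μ⁴⁰, 5μ³⁹, 0)` — in characteristic 2 the initial form of
`∂_y fW ∈ Diff⁽¹⁾(fW)` at `Γ₂(μ)` is `μ³⁹·w̄` (ORDER 1 for `μ ≠ 0`). [folklore] -/
theorem W2_grad_Dy (μ : R) :
    eval (ptG2 μ) (pderiv 0 (Dy : (MvPolynomial (Fin 5) R))) = 0 ∧ eval (ptG2 μ) (pderiv 1 (Dy : (MvPolynomial (Fin 5) R))) = 0 ∧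
      eval (ptG2 μ) (pderiv 2 (Dy : (MvPolynomial (Fin 5) R))) = 12 * μ ^ 40 ∧ eval (ptG2 μ) (pderiv 3 (Dy : (MvPolynomial (Fin 5) R))) = 5 * μ ^ 39 ∧
      eval (ptG2 μ) (pderiv 4 (Dy : (MvPolynomial (Fin 5) R))) = 0 := by
  refine ⟨?_, ?_, ?_, ?_, ?_⟩ <;>
  · simp [Dy, ptG2, Derivation.leibniz, Derivation.leibniz_pow, pderiv_X, smul_eq_mul]
    try ring

/-- Gradient of `∂_w fW` at `Γ₂(μ)`: `(0, 5μ³⁹, 0, 0, 0)` — initial form `5μ³⁹·ȳ` (characteristic 2: `μ³⁹ȳ`),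
independent of the initial form of `∂_y fW`: `t(Γ₂(μ)) ≥ 2` for `μ ≠ 0`. [folklore] -/
theorem W2_grad_Dw (μ : R) :
    eval (ptG2 μ) (pderiv 0 (Dw : (MvPolynomial (Fin 5) R))) = 0 ∧ eval (ptG2 μ) (pderiv 1 (Dw : (MvPolynomial (Fin 5) R))) = 5 * μ ^ 39 ∧
      eval (ptG2 μ) (pderiv 2 (Dw : (MvPolynomial (Fin 5) R))) = 0 ∧ eval (ptG2 μ) (pderiv 3 (Dw : (MvPolynomial (Fin 5) R))) = 0 ∧
      eval (ptG2 μ) (pderiv 4 (Dw : (MvPolynomial (Fin 5) R))) = 0 := by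
  refine ⟨?_, ?_, ?_, ?_, ?_⟩ <;>
  · simp [Dw, ptG2, Derivation.leibniz, Derivation.leibniz_pow, pderiv_X, smul_eq_mul]
    try ring

/-- `∂_z∂_y fW`. [folklore] -/
noncomputable def Dyz : (MvPolynomial (Fin 5) R) :=
  2 * X 2 * X 3 * X 4 ^ 4 + 3 * X 2 ^ 2 * X 3 ^ 5 + 4 * X 1 ^ 3 * X 3 ^ 2 * X 4 ^ 2 + 9 * X 2 ^ 8
/-- `∂_w∂_y fW`. [folklore] -/
noncomputable def Dyw : (MvPolynomial (Fin 5) R) := X 2 ^ 2 * X 4 ^ 4 + 5 * X 2 ^ 3 * X 3 ^ 4 + 8 * X 1 ^ 3 * X 2 * X 3 * X 4 ^ 2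
/-- `∂_w∂_z fW`. [folklore] -/
noncomputable def Dzw : (MvPolynomial (Fin 5) R) :=
  5 * X 3 ^ 4 * X 4 ^ 2 + 2 * X 1 * X 2 * X 4 ^ 4 + 15 * X 1 * X 2 ^ 2 * X 3 ^ 4 + 2 * X 1 ^ 4 * X 3 * X 4 ^ 2

/-- `∂_z Dy = Dyz`. [folklore] -/
theorem pderiv2_Dy : pderiv 2 (Dy : (MvPolynomial (Fin 5) R)) = Dyz := by
  simp only [Dy, Dyz]
  simp [Derivation.leibniz, Derivation.leibniz_pow, pderiv_X, smul_eq_mul]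
  ring
/-- `∂_w Dy = Dyw`. [folklore] -/
theorem pderiv3_Dy : pderiv 3 (Dy : (MvPolynomial (Fin 5) R)) = Dyw := by
  simp only [Dy, Dyw]
  simp [Derivation.leibniz, Derivation.leibniz_pow, pderiv_X, smul_eq_mul]
  ring
/-- `∂_w Dz = Dzw`. [folklore] -/
theorem pderiv3_Dz : pderiv 3 (Dz : (MvPolynomial (Fin 5) R)) = Dzw := by
  simp only [Dz, Dzw]
  simp [Derivation.leibniz, Derivation.leibniz_pow, pderiv_X, smul_eq_mul]
  ring
/-- `∂_y Dw = Dyw` (symmetry of mixed partials). [folklore] -/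
theorem pderiv1_Dw : pderiv 1 (Dw : (MvPolynomial (Fin 5) R)) = Dyw := by
  simp only [Dw, Dyw]
  simp [Derivation.leibniz, Derivation.leibniz_pow, pderiv_X, smul_eq_mul]
  ring

/-- The mixed coefficients of the tangent quadric along `Γ₂(μ)`: `(∂_y∂_z, ∂_y∂_w, ∂_z∂_w) fW = (12μ⁴⁰, 5μ³⁹, 0)`
— in characteristic 2 the quadric has the cross term `μ³⁹ȳw̄` (NOT diagonal), whereas on `γ` all three are even
(`W2_cross_gamma`). [folklore] -/
theorem W2_cross_G2 :
    gammaTwo (Dyz : (MvPolynomial (Fin 5) R)) = 12 * X 0 ^ 40 ∧ gammaTwo (Dyw : (MvPolynomial (Fin 5) R)) = 5 * X 0 ^ 39 ∧ gammaTwo (Dzw : (MvPolynomial (Fin 5) R)) = 0 := by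
  refine ⟨?_, ?_, ?_⟩
  · simp only [gammaTwo, Dyz, map_add, map_mul, map_pow, bind₁_X_right, Matrix.cons_val_zero, Matrix.cons_val_one,
      Matrix.cons_val, map_ofNat]; ring
  · simp only [gammaTwo, Dyw, map_add, map_mul, map_pow, bind₁_X_right, Matrix.cons_val_zero, Matrix.cons_val_one,
      Matrix.cons_val, map_ofNat]; ring
  · simp only [gammaTwo, Dzw, map_add, map_mul, map_pow, bind₁_X_right, Matrix.cons_val_zero, Matrix.cons_val_one,
      Matrix.cons_val, map_ofNat]; ring

/-- On `γ(s)` the three mixed second partials are `18s¹⁶⁰, 14s¹⁵⁶, 24s¹⁵⁴` — all `2·(…)`: in characteristic 2 the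
tangent quadric along `γ` is diagonal and no first partial of `fW` acquires a linear term there (contrast
`W2_grad_Dy`). [folklore] -/
theorem W2_cross_gamma :
    gammaW (Dyz : (MvPolynomial (Fin 5) R)) = 18 * X 0 ^ 160 ∧ gammaW (Dyw : (MvPolynomial (Fin 5) R)) = 14 * X 0 ^ 156 ∧ gammaW (Dzw : (MvPolynomial (Fin 5) R)) = 24 * X 0 ^ 154 := by
  refine ⟨?_, ?_, ?_⟩
  · simp only [gammaW, Dyz, map_add, map_mul, map_pow, bind₁_X_right, Matrix.cons_val_zero, Matrix.cons_val_one,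
      Matrix.cons_val, map_ofNat]; ring
  · simp only [gammaW, Dyw, map_add, map_mul, map_pow, bind₁_X_right, Matrix.cons_val_zero, Matrix.cons_val_one,
      Matrix.cons_val, map_ofNat]; ring
  · simp only [gammaW, Dzw, map_add, map_mul, map_pow, bind₁_X_right, Matrix.cons_val_zero, Matrix.cons_val_one,
      Matrix.cons_val, map_ofNat]; ring

/-! ### The origin: linear forms vanishing on `γ` -/

/-- The weights `w = (99,18,20,24,29)` of `γ`. [folklore] -/
def gammaWeights : Fin 5 → ℕ := ![99, 18, 20, 24, 29]

/-- `γ` as a map to the polynomial ring in one variable `s`: `xᵢ ↦ s^{wᵢ}`. [folklore] -/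
noncomputable def gammaP : (MvPolynomial (Fin 5) R) →ₐ[R] Polynomial R :=
  MvPolynomial.aeval (R := R) (S₁ := Polynomial R) (fun i : Fin 5 => (Polynomial.X : Polynomial R) ^ gammaWeights i)

/-- The maximal ideal `𝔪 = (x,y,z,w,v)` of the origin of `𝔸⁵`. [folklore] -/
noncomputable def M5 : Ideal (MvPolynomial (Fin 5) R) := Ideal.span (Set.range (X : Fin 5 → (MvPolynomial (Fin 5) R)))

/-- `γ*(𝔪) ⊆ (s¹⁸)`: every weight is `≥ 18`. [folklore] -/
theorem map_gammaP_M5 :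
    Ideal.map gammaP (M5 : Ideal (MvPolynomial (Fin 5) R)) ≤ Ideal.span {(Polynomial.X : Polynomial R) ^ 18} := by
  rw [M5, Ideal.map_span, Ideal.span_le]
  rintro g ⟨g', ⟨i, rfl⟩, rfl⟩
  simp only [gammaP, MvPolynomial.aeval_X, SetLike.mem_coe]
  refine Ideal.mem_span_singleton.2 (pow_dvd_pow _ ?_)
  fin_cases i <;> simp [gammaWeights]

/-- `γ*(𝔪²) ⊆ (s³⁶)`. [folklore] -/
theorem gammaP_of_mem_sq {r : (MvPolynomial (Fin 5) R)} (hr : r ∈ (M5 : Ideal (MvPolynomial (Fin 5) R)) ^ 2) :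
    ∃ q : Polynomial R, gammaP r = (Polynomial.X : Polynomial R) ^ 36 * q := by
  have h1 := Ideal.mem_map_of_mem gammaP hr
  rw [Ideal.map_pow] at h1
  have h2 : Ideal.map gammaP (M5 : Ideal (MvPolynomial (Fin 5) R)) ^ 2 ≤ Ideal.span {(Polynomial.X : Polynomial R) ^ 36} := by
    have h := Ideal.pow_right_mono (map_gammaP_M5 (R := R)) 2
    rw [Ideal.span_singleton_pow, ← pow_mul] at h
    exact h
  obtain ⟨a, ha⟩ := Ideal.mem_span_singleton'.mp (h2 h1)
  exact ⟨a, by rw [← ha, mul_comm]⟩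

/-- **`t(0) ≤ 1` for W2.** If a germ `h = c_x x + c_y y + c_z z + c_w w + c_v v + r`, `r ∈ 𝔪²`, vanishes identically
on `γ` (as every element of `℘(E,1)_0` does, `γ ⊂ Sing(E)` — (℘-geo) level 0), then `c_y = c_z = c_w = c_v = 0`: the
coefficients of `s¹⁸, s²⁰, s²⁴, s²⁹` in `h(γ(s))` are exactly these (all weights of `𝔪²` are `≥ 36`). [folklore] -/
theorem origin_linear_coeffs (cx cy cz cw cv : R) {r : (MvPolynomial (Fin 5) R)} (hr : r ∈ (M5 : Ideal (MvPolynomial (Fin 5) R)) ^ 2)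
    (h : gammaP (C cx * X 0 + C cy * X 1 + C cz * X 2 + C cw * X 3 + C cv * X 4 + r) = 0) :
    cy = 0 ∧ cz = 0 ∧ cw = 0 ∧ cv = 0 := by
  obtain ⟨q, hq⟩ := gammaP_of_mem_sq hr
  have e : gammaP (C cx * X 0 + C cy * X 1 + C cz * X 2 + C cw * X 3 + C cv * X 4 + r) =
      Polynomial.C cx * Polynomial.X ^ 99 + Polynomial.C cy * Polynomial.X ^ 18 + Polynomial.C cz * Polynomial.X ^ 20
        + Polynomial.C cw * Polynomial.X ^ 24 + Polynomial.C cv * Polynomial.X ^ 29 + Polynomial.X ^ 36 * q := by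
    rw [map_add, hq]
    simp only [map_add, map_mul, gammaP, gammaWeights, MvPolynomial.aeval_X, MvPolynomial.algHom_C,
      Polynomial.algebraMap_eq, Matrix.cons_val_zero, Matrix.cons_val_one, Matrix.cons_val]
  rw [e] at h
  have c18 := congrArg (Polynomial.coeff · 18) h
  have c20 := congrArg (Polynomial.coeff · 20) h
  have c24 := congrArg (Polynomial.coeff · 24) h
  have c29 := congrArg (Polynomial.coeff · 29) h
  simp only [Polynomial.coeff_add, Polynomial.coeff_C_mul, Polynomial.coeff_X_pow, Polynomial.coeff_X_pow_mul',
    Polynomial.coeff_zero] at c18 c20 c24 c29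
  norm_num at c18 c20 c24 c29
  exact ⟨c18, c20, c24, c29⟩

end W2

end Summit.ResolutionOfSingularities.ResolutionOfSingularities.Theorems.CampaignW32WQTopLocus
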